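import Mathlib
import HarnessLib.Audit
import Summits.PneNP.PneNP.Theorems.ClusUniversalCertificateCoordTransfer
import Summits.PneNP.PneNP.Theorems.ClusUniversalCertificateTreeCountSet

/-!
# Route ClusUniversalCertificate — TREE-COUNT ⟹ the crux `UniversalCertAll` (stmt-PneNP-19683), by name
(rung F-N1, cell pnp-ideate, planner p1 g12 ROUND-12; the route-facing compositions of the planner's file
`HOME/pnp-ideate-p1/lines/treecount-TCS-UNREGISTERED.lean` sha16 `007948cc58786841` — statements byte-faithful — kept apart from the
route-independent object files `ClusUniversalCertificateTreeCount` / `…TreeCountSet` so that those do not sit in the route file's import cone)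

Each open node of the typed lattice, assumed in every total dimension `M`, gives the crux through the landed registered stub
`ClusUniversalCertificateCoordTransfer.stub_transfer : (∀ M, UCMixDim M) → UniversalCertAll`:
`universalCertAll_of_tcm` (`TCMId`), `universalCertAll_of_tcmMin` (`TCMmin`), `universalCertAll_of_tcsMin` (`TCSmin`),
`universalCertAll_of_lspMin` (`LSPmin`).  These are CONDITIONAL results (the hypotheses are `@[conjecture]` nodes, OPEN); nothing is closed.
HONEST FRAMING: FRONTIER rung F-N1, restricted-model combinatorics — nothing here bears on `P` versus `NP`.
-/

set_option linter.dupNamespace false -- `Summit.PneNP.PneNP.…`: summit = sub-problem name (D-0017 single-conjunct layout)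

namespace Summit.PneNP.PneNP.Theorems.ClusCoord

/-- composition with the crux (uses the landed `stub_transfer`). -/
theorem universalCertAll_of_tcm (h : ∀ M, TCMId M) :
    Summit.PneNP.PneNP.Theses.ClusUniversalCertificate.UniversalCertAll :=
  stub_transfer (fun M => tcm_gives_uc M (h M))

/-- the translation-invariant tree count alone implies the crux (kernel-checked chain
`TCMmin → TCMId → UCMixDim → UniversalCertAll`; only `TCMmin` itself is open). -/
theorem universalCertAll_of_tcmMin (h : ∀ M, TCMmin M) :
    Summit.PneNP.PneNP.Theses.ClusUniversalCertificate.UniversalCertAll :=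
  universalCertAll_of_tcm (fun M => tcmMin_gives_tcm M (h M))

/-- the whole chain from the set version: `TCSmin M` for all `M` gives the crux. -/
theorem universalCertAll_of_tcsMin (h : ∀ M, TCSmin M) :
    Summit.PneNP.PneNP.Theses.ClusUniversalCertificate.UniversalCertAll :=
  universalCertAll_of_tcmMin fun M => tcsMin_gives_tcmMin M (h M)

/-- the whole chain from local saturation: `LSPmin M` for all `M` gives the crux. -/
theorem universalCertAll_of_lspMin (h : ∀ M, LSPmin M) :
    Summit.PneNP.PneNP.Theses.ClusUniversalCertificate.UniversalCertAll :=
  universalCertAll_of_tcsMin fun M => lspMin_gives_tcsMin M (h M)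

end Summit.PneNP.PneNP.Theorems.ClusCoord
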